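import Literature.Analysis.FluidPDE.PassiveVectorTensorClass
import Literature.Analysis.FluidPDE.PassiveVectorSuperposition
import Mathlib.MeasureTheory.Measure.Haar.NormedSpace
import HarnessLib

/-!
# Time dilation of weak TENSOR-viscosity passive-vector solutions on `T^d`

Analysis/FluidPDE proof-support file (everything proved; no new definitions, no named facts).  The weak class
`Torus.IsWeakTensorPassiveVectorOn A T 𝔸 b w₀ w` (Frisch (9.57) along a carrier, weak form of DiPerna–Lions 1989 §II.1) is
covariant under the rescaling of time `t = a·s` (`a > 0`): if `w` solves on `[0,T)` along `b` with tensor `𝔸`, then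
`s ↦ w(a s)` solves on `[0, T/a)` along the carrier `s ↦ a • b(a s)` with tensor `a • 𝔸`, from the same datum
(`IsWeakTensorPassiveVectorOn.comp_mul_time`): `∂ₛ(w∘(a·)) = a (∂ₜw)∘(a·)`.  The proof transports every bookkeeping clause along
the measurable embedding `s ↦ a s` (Lebesgue measure scales by `a⁻¹`) and tests the original identity against `Φ(t,x) = Ψ(t/a, x)`.

Consumer: the K1L one-level step (`stub_oneLevelL` of `LagrangianRenormalisationStep`, route `SolenoidalFractalHomogenisation`, cell
`ad-ideate`): PHYSICAL time `t` of the level-`(m+1)` problem versus CELL time `s = a_{m+1} t` of the cell clauses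
(`…LagrangianStepOneLevelScales`: `kbar (m+1) • S = a (m+1) • ((1/n²) • (ν • S))`, `level (m+1) t = a (m+1) • cellField … (a (m+1) t)`).

## Mathlib / tree search

Mathlib: `Real.map_volume_mul_left` (the tree's `FluidPDE.quasiMeasurePreserving_mul_left` lives in the heavy DSS module and is inlined here), `Homeomorph.mulLeft₀` (measurable embedding), `MeasurableEmbedding.lintegral_map`,
`MeasurableEmbedding.restrict_map`, `Measure.QuasiMeasurePreserving.{ae, prodMap}`, `Measure.restrict_map`,
`AEStronglyMeasurable.comp_quasiMeasurePreserving`, `MeasureTheory.integral_comp_mul_left`, `integral_indicator`, `HasDerivAt.scomp`.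
Tree: `PassiveVectorTensorClass` (class API), `PassiveVectorSuperposition` (`IsWeaklyDivFree.const_smul'`), `viscAdj_smul`.
No time-rescaling lemma for either weak passive-vector class existed (2026-08-28).

## References

* R. J. DiPerna, P.-L. Lions, Invent. Math. 98 (1989) 511–547, §II.1 (12)–(14). [`DiPernaLions1989`]
* U. Frisch, *Turbulence* (CUP 1995), §9.6.3 eq. (9.57) p. 233. [`Frisch1995Turbulence`]
-/

noncomputable section

open MeasureTheory TopologicalSpace Set Function Filter Topology UnitAddTorus
open scoped ENNReal NNReal InnerProductSpace

namespace Literature.Analysis.FluidPDE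

namespace Torus

variable {d : Type*} [Fintype d] [DecidableEq d]

/-! ## Scaling of time: measure-theoretic transport along `s ↦ a s` -/

omit [Fintype d] [DecidableEq d] in
/-- Transport of an a.e. statement on `(0,T)` to `(0,T/a)` along `s ↦ a s` (`a > 0`). [cite: DiPernaLions1989, §II.1 (12)–(14)] -/
theorem ae_Ioo_comp_mul {a T : ℝ} (ha : 0 < a) {P : ℝ → Prop} (h : ∀ᵐ t ∂(volume.restrict (Ioo 0 T)), P t) :
    ∀ᵐ s ∂(volume.restrict (Ioo 0 (T / a))), P (a * s) := by
  have h' : ∀ᵐ t ∂(volume : Measure ℝ), t ∈ Ioo 0 T → P t := (ae_restrict_iff' measurableSet_Ioo).1 h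
  have h2 := (⟨measurable_const_mul a, by rw [Real.map_volume_mul_left ha.ne']; exact Measure.smul_absolutelyContinuous⟩ : Measure.QuasiMeasurePreserving (fun s : ℝ => a * s) volume volume) |>.ae h'
  refine (ae_restrict_iff' measurableSet_Ioo).2 ?_
  filter_upwards [h2] with s hs hsI
  refine hs ⟨mul_pos ha hsI.1, ?_⟩
  calc a * s < a * (T / a) := mul_lt_mul_of_pos_left hsI.2 ha
    _ = T := mul_div_cancel₀ T ha.ne'

omit [Fintype d] [DecidableEq d] in
/-- Substitution `t = a s` in a lower Lebesgue integral over `(0,T)`: `∫⁻_{(0,T/a)} f(a s) ds = a⁻¹ ∫⁻_{(0,T)} f` (`a > 0`;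
no measurability needed). [cite: DiPernaLions1989, §II.1 (12)–(14)] -/
theorem lintegral_Ioo_comp_mul {a T : ℝ} (ha : 0 < a) (f : ℝ → ℝ≥0∞) :
    ∫⁻ s in Ioo 0 (T / a), f (a * s) = ENNReal.ofReal a⁻¹ * ∫⁻ t in Ioo 0 T, f t := by
  have hemb : MeasurableEmbedding (fun s : ℝ => a * s) := (Homeomorph.mulLeft₀ a ha.ne').measurableEmbedding
  have hpre : (fun s : ℝ => a * s) ⁻¹' Ioo 0 T = Ioo 0 (T / a) := by
    ext s
    simp only [mem_preimage, mem_Ioo]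
    constructor
    · rintro ⟨h1, h2⟩
      refine ⟨pos_of_mul_pos_right h1 ha.le, ?_⟩
      rw [lt_div_iff₀ ha]; linarith [mul_comm a s]
    · rintro ⟨h1, h2⟩
      refine ⟨mul_pos ha h1, ?_⟩
      calc a * s < a * (T / a) := mul_lt_mul_of_pos_left h2 ha
        _ = T := mul_div_cancel₀ T ha.ne'
  have h1 : ∫⁻ t in Ioo 0 T, f t ∂(Measure.map (fun s : ℝ => a * s) volume) =
      ∫⁻ s in Ioo 0 (T / a), f (a * s) := by
    rw [hemb.restrict_map, hemb.lintegral_map, hpre]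
  rw [← h1, Real.map_volume_mul_left ha.ne', Measure.restrict_smul, lintegral_smul_measure, abs_of_pos (inv_pos.2 ha),
    smul_eq_mul]

omit [Fintype d] [DecidableEq d] in
/-- Substitution `t = a s` in a Bochner integral over `(0,T)`: `∫_{(0,T/a)} g(a s) ds = a⁻¹ ∫_{(0,T)} g` (`a > 0`).
[cite: DiPernaLions1989, §II.1 (12)–(14)] -/
theorem integral_Ioo_comp_mul {a T : ℝ} (ha : 0 < a) (g : ℝ → ℝ) :
    ∫ s in Ioo 0 (T / a), g (a * s) = a⁻¹ * ∫ t in Ioo 0 T, g t := by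
  have hpre : ∀ s, s ∈ Ioo 0 (T / a) ↔ a * s ∈ Ioo 0 T := by
    intro s
    simp only [mem_Ioo]
    constructor
    · rintro ⟨h1, h2⟩
      refine ⟨mul_pos ha h1, ?_⟩
      calc a * s < a * (T / a) := mul_lt_mul_of_pos_left h2 ha
        _ = T := mul_div_cancel₀ T ha.ne'
    · rintro ⟨h1, h2⟩
      refine ⟨pos_of_mul_pos_right h1 ha.le, ?_⟩
      rw [lt_div_iff₀ ha]; linarith [mul_comm a s]
  have e1 : (fun s => (Ioo 0 T).indicator g (a * s)) = (Ioo 0 (T / a)).indicator (fun s => g (a * s)) := by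
    funext s
    by_cases hs : s ∈ Ioo 0 (T / a)
    · rw [indicator_of_mem hs, indicator_of_mem ((hpre s).1 hs)]
    · rw [indicator_of_notMem hs, indicator_of_notMem (fun h => hs ((hpre s).2 h))]
  rw [← integral_indicator measurableSet_Ioo, ← integral_indicator measurableSet_Ioo, ← e1,
    MeasureTheory.Measure.integral_comp_mul_left (fun t => (Ioo 0 T).indicator g t) a, abs_of_pos (inv_pos.2 ha), smul_eq_mul]

omit [DecidableEq d] in
/-- The space–time dilation `(s, y) ↦ (a s, y)` is quasi-measure-preserving between the slabs `(0,T/a) × ℝ^d` and `(0,T) × ℝ^d`.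
[cite: DiPernaLions1989, §II.1 (12)–(14)] -/
theorem quasiMeasurePreserving_timeDilate {a : ℝ} (ha : 0 < a) (T : ℝ) :
    Measure.QuasiMeasurePreserving (fun p : ℝ × EuclideanSpace ℝ d => (a * p.1, p.2))
      ((volume : Measure (ℝ × EuclideanSpace ℝ d)).restrict (Ioo 0 (T / a) ×ˢ univ))
      ((volume : Measure (ℝ × EuclideanSpace ℝ d)).restrict (Ioo 0 T ×ˢ univ)) := by
  have hΦ : Measure.QuasiMeasurePreserving (fun p : ℝ × EuclideanSpace ℝ d => (a * p.1, p.2))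
      (volume : Measure (ℝ × EuclideanSpace ℝ d)) volume :=
    MeasureTheory.QuasiMeasurePreserving.prodMap (⟨measurable_const_mul a, by rw [Real.map_volume_mul_left ha.ne']; exact Measure.smul_absolutelyContinuous⟩ : Measure.QuasiMeasurePreserving (fun s : ℝ => a * s) volume volume) (Measure.QuasiMeasurePreserving.id volume)
  have hmeas : Measurable (fun p : ℝ × EuclideanSpace ℝ d => (a * p.1, p.2)) := hΦ.measurable
  have hpre : (fun p : ℝ × EuclideanSpace ℝ d => (a * p.1, p.2)) ⁻¹' (Ioo 0 T ×ˢ (univ : Set (EuclideanSpace ℝ d))) =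
      Ioo 0 (T / a) ×ˢ univ := by
    ext p
    simp only [mem_preimage, mem_prod, mem_univ, and_true, mem_Ioo]
    constructor
    · rintro ⟨h1, h2⟩
      refine ⟨pos_of_mul_pos_right h1 ha.le, ?_⟩
      rw [lt_div_iff₀ ha]; linarith [mul_comm a p.1]
    · rintro ⟨h1, h2⟩
      refine ⟨mul_pos ha h1, ?_⟩
      calc a * p.1 < a * (T / a) := mul_lt_mul_of_pos_left h2 ha
        _ = T := mul_div_cancel₀ T ha.ne'
  refine ⟨hmeas, ?_⟩
  rw [← hpre, ← Measure.restrict_map hmeas (measurableSet_Ioo.prod MeasurableSet.univ)]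
  exact hΦ.absolutelyContinuous.restrict _

/-! ## Dilated test fields -/

omit [DecidableEq d] in
/-- Time slices of a space–time test field are differentiable in time, with derivative `timeDeriv`. [cite: Temam1984, Ch. III §1.1 (test functions)] -/
theorem IsSpaceTimeTest.hasDerivAt_slice {F : Type*} [NormedAddCommGroup F] [NormedSpace ℝ F]
    {T : ℝ} {ψ : ℝ → UnitAddTorus d → F} (hψ : FunctionSpaces.Torus.IsSpaceTimeTest T ψ) (x : UnitAddTorus d) (t : ℝ) :
    HasDerivAt (fun τ => ψ τ x) (FunctionSpaces.Torus.timeDeriv ψ t x) t := by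
  obtain ⟨y, rfl⟩ := FunctionSpaces.Torus.proj_surjective x
  have e : (fun τ => ψ τ (FunctionSpaces.Torus.proj y)) = FunctionSpaces.Torus.stLift ψ ∘ fun τ => (τ, y) := by
    funext τ; simp [FunctionSpaces.Torus.stLift_apply]
  have hdiff : Differentiable ℝ (fun τ => ψ τ (FunctionSpaces.Torus.proj y)) := by
    rw [e]
    exact (hψ.1.differentiable (by simp)).comp (differentiable_id.prodMk (differentiable_const _))
  exact (hdiff t).hasDerivAt

omit [DecidableEq d] in
/-- The dilated test field `Φ(t, x) = Ψ(a⁻¹ t, x)` of a test field on `[0, T/a)` is a test field on `[0,T)` (`a > 0`), with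
`∂ₜΦ(t) = a⁻¹ ∂ₛΨ(a⁻¹ t)`. [cite: Temam1984, Ch. III §1.1 (test functions)] -/
theorem IsSpaceTimeTest.comp_inv_mul_time {F : Type*} [NormedAddCommGroup F] [NormedSpace ℝ F]
    {a T : ℝ} (ha : 0 < a) {Ψ : ℝ → UnitAddTorus d → F} (hΨ : FunctionSpaces.Torus.IsSpaceTimeTest (T / a) Ψ) :
    FunctionSpaces.Torus.IsSpaceTimeTest T (fun t x => Ψ (a⁻¹ * t) x) ∧
      ∀ t x, FunctionSpaces.Torus.timeDeriv (fun t x => Ψ (a⁻¹ * t) x) t x = a⁻¹ • FunctionSpaces.Torus.timeDeriv Ψ (a⁻¹ * t) x := by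
  refine ⟨⟨?_, ?_⟩, ?_⟩
  · have e : FunctionSpaces.Torus.stLift (fun t x => Ψ (a⁻¹ * t) x) =
        FunctionSpaces.Torus.stLift Ψ ∘ fun p : ℝ × EuclideanSpace ℝ d => (a⁻¹ * p.1, p.2) := by
      funext p
      rfl
    rw [e]
    exact hΨ.1.comp ((contDiff_const.mul contDiff_fst).prodMk contDiff_snd)
  · obtain ⟨T', hT', hz⟩ := hΨ.2
    refine ⟨a * T', ?_, fun t ht => ?_⟩
    · calc a * T' < a * (T / a) := mul_lt_mul_of_pos_left hT' ha
        _ = T := mul_div_cancel₀ T ha.ne'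
    · funext x
      have h1 : T' ≤ a⁻¹ * t := by
        rw [le_inv_mul_iff₀ ha]; linarith [mul_comm a T']
      simp only [hz _ h1, Pi.zero_apply]
  · intro t x
    have h1 := IsSpaceTimeTest.hasDerivAt_slice hΨ x (a⁻¹ * t)
    have h2 : HasDerivAt (fun τ : ℝ => a⁻¹ * τ) a⁻¹ t := by simpa using (hasDerivAt_id t).const_mul a⁻¹
    have h3 := h1.scomp t h2
    exact h3.deriv

/-! ## Time dilation of weak solutions -/

namespace IsWeakTensorPassiveVectorOn

variable {A T : ℝ} {𝔸 : Visc4 d} {b w : ℝ → UnitAddTorus d → EuclideanSpace ℝ d}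
  {w₀ : UnitAddTorus d → EuclideanSpace ℝ d}

/-- **Time dilation.**  If `w` is a weak solution of `∂ₜw + (b·∇)w + A (w·∇)b + ∇π = 𝓛_𝔸 w`, `∇·w = 0` on `T^d × [0,T)` from `w₀`,
then for every `a > 0` the dilated field `s ↦ w(a s)` is a weak solution on `[0, T/a)` along `s ↦ a • b(a s)` with tensor `a • 𝔸`
from the same datum. [cite: DiPernaLions1989, §II.1 (12)–(14)] -/
theorem comp_mul_time (h : IsWeakTensorPassiveVectorOn A T 𝔸 b w₀ w) {a : ℝ} (ha : 0 < a) :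
    IsWeakTensorPassiveVectorOn A (T / a) (a • 𝔸) (fun s x => a • b (a * s) x) w₀ (fun s x => w (a * s) x) where
  aestronglyMeasurable := by
    have e : FunctionSpaces.Torus.stLift (fun s x => w (a * s) x) =
        FunctionSpaces.Torus.stLift w ∘ fun p : ℝ × EuclideanSpace ℝ d => (a * p.1, p.2) := by
      funext p; rfl
    rw [e]
    exact h.aestronglyMeasurable.comp_quasiMeasurePreserving (quasiMeasurePreserving_timeDilate ha T)
  aestronglyMeasurable_carrier := by
    have e : FunctionSpaces.Torus.stLift (fun s x => a • b (a * s) x) =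
        fun p => a • (FunctionSpaces.Torus.stLift b ∘ fun p : ℝ × EuclideanSpace ℝ d => (a * p.1, p.2)) p := by
      funext p; rfl
    rw [e]
    exact (h.aestronglyMeasurable_carrier.comp_quasiMeasurePreserving (quasiMeasurePreserving_timeDilate ha T)).const_smul a
  ae_lintegral_sq_le := by
    obtain ⟨C, hC⟩ := h.ae_lintegral_sq_le
    exact ⟨C, ae_Ioo_comp_mul ha hC⟩
  lintegral_carrier_lt_top := by
    have hsubst := lintegral_Ioo_comp_mul (T := T) ha (fun t => (∫⁻ x, ‖a • b t x‖ₑ ^ 2) ^ (1 / 2 : ℝ))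
    rw [hsubst]
    refine ENNReal.mul_lt_top ENNReal.ofReal_lt_top ?_
    have e2 : ∀ t, (∫⁻ x, ‖a • b t x‖ₑ ^ 2) ^ (1 / 2 : ℝ) = ‖a‖ₑ * (∫⁻ x, ‖b t x‖ₑ ^ 2) ^ (1 / 2 : ℝ) := by
      intro t
      have e3 : ∫⁻ x, ‖a • b t x‖ₑ ^ 2 = ‖a‖ₑ ^ 2 * ∫⁻ x, ‖b t x‖ₑ ^ 2 := by
        rw [← lintegral_const_mul' _ _ (by simp)]
        refine lintegral_congr fun x => ?_
        rw [enorm_smul, mul_pow]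
      rw [e3, ENNReal.mul_rpow_of_nonneg _ _ (by norm_num), ← ENNReal.rpow_natCast, ← ENNReal.rpow_mul]
      norm_num
    simp_rw [e2]
    rw [lintegral_const_mul' _ _ (by simp)]
    exact ENNReal.mul_lt_top (by simp) h.lintegral_carrier_lt_top
  lintegral_mul_lt_top := by
    have hsubst := lintegral_Ioo_comp_mul (T := T) ha (fun t => ∫⁻ x, ‖a • b t x‖ₑ * ‖w t x‖ₑ)
    rw [hsubst]
    refine ENNReal.mul_lt_top ENNReal.ofReal_lt_top ?_
    have e2 : ∀ t, (∫⁻ x, ‖a • b t x‖ₑ * ‖w t x‖ₑ) = ‖a‖ₑ * ∫⁻ x, ‖b t x‖ₑ * ‖w t x‖ₑ := by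
      intro t
      rw [← lintegral_const_mul' _ _ (by simp)]
      refine lintegral_congr fun x => ?_
      rw [enorm_smul, mul_assoc]
    simp_rw [e2]
    rw [lintegral_const_mul' _ _ (by simp)]
    exact ENNReal.mul_lt_top (by simp) h.lintegral_mul_lt_top
  ae_isWeaklyDivFree_carrier := by
    filter_upwards [ae_Ioo_comp_mul ha h.ae_isWeaklyDivFree_carrier] with s hs
    exact hs.const_smul' a
  ae_isWeaklyDivFree := ae_Ioo_comp_mul ha h.ae_isWeaklyDivFree
  weak_eq Ψ hΨ hΨdiv := by
    -- test the original identity against the dilated field `Φ t x = Ψ (a⁻¹ t) x`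
    obtain ⟨hΦ, hΦderiv⟩ := IsSpaceTimeTest.comp_inv_mul_time ha hΨ
    have hΦdiv : ∀ t, FunctionSpaces.Torus.IsDivFree ((fun t x => Ψ (a⁻¹ * t) x) t) := fun t => hΨdiv (a⁻¹ * t)
    have key := h.weak_eq (fun t x => Ψ (a⁻¹ * t) x) hΦ hΦdiv
    -- the inner integrals: new integrand at `s` = `a ×` old integrand at `t = a s`
    set G : ℝ → ℝ := fun t => ∫ x, (⟪w t x, FunctionSpaces.Torus.timeDeriv (fun t x => Ψ (a⁻¹ * t) x) t x +
          FunctionSpaces.Torus.convect (b t) ((fun t x => Ψ (a⁻¹ * t) x) t) x + viscAdj 𝔸 ((fun t x => Ψ (a⁻¹ * t) x) t) x⟫_ℝ +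
        A * ⟪b t x, FunctionSpaces.Torus.convect (w t) ((fun t x => Ψ (a⁻¹ * t) x) t) x⟫_ℝ) with hG
    have hpt : ∀ s, (∫ x, (⟪w (a * s) x, FunctionSpaces.Torus.timeDeriv Ψ s x +
          FunctionSpaces.Torus.convect (fun y => a • b (a * s) y) (Ψ s) x + viscAdj (a • 𝔸) (Ψ s) x⟫_ℝ +
        A * ⟪a • b (a * s) x, FunctionSpaces.Torus.convect (w (a * s)) (Ψ s) x⟫_ℝ)) = a * G (a * s) := by
      intro s
      rw [hG]
      simp only
      rw [← integral_const_mul]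
      refine integral_congr_ae (ae_of_all _ fun x => ?_)
      dsimp only
      have e1 : FunctionSpaces.Torus.timeDeriv (fun t x => Ψ (a⁻¹ * t) x) (a * s) x = a⁻¹ • FunctionSpaces.Torus.timeDeriv Ψ s x := by
        rw [hΦderiv, ← mul_assoc, inv_mul_cancel₀ ha.ne', one_mul]
      have e2 : (fun x => Ψ (a⁻¹ * (a * s)) x) = Ψ s := by
        funext y; rw [← mul_assoc, inv_mul_cancel₀ ha.ne', one_mul]
      have e3 : FunctionSpaces.Torus.convect (fun y => a • b (a * s) y) (Ψ s) x = a • FunctionSpaces.Torus.convect (b (a * s)) (Ψ s) x := by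
        simp only [FunctionSpaces.Torus.convect, map_smul]
      rw [e1, e3, viscAdj_smul]
      change _ = a * (⟪w (a * s) x, a⁻¹ • FunctionSpaces.Torus.timeDeriv Ψ s x +
          FunctionSpaces.Torus.convect (b (a * s)) (fun x => Ψ (a⁻¹ * (a * s)) x) x + viscAdj 𝔸 (fun x => Ψ (a⁻¹ * (a * s)) x) x⟫_ℝ +
        A * ⟪b (a * s) x, FunctionSpaces.Torus.convect (w (a * s)) (fun x => Ψ (a⁻¹ * (a * s)) x) x⟫_ℝ)
      rw [e2]
      simp only [inner_add_right, inner_smul_right, real_inner_smul_left]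
      field_simp
    have hsub : ∫ s in Ioo 0 (T / a), a * G (a * s) = ∫ t in Ioo 0 T, G t := by
      rw [integral_const_mul, integral_Ioo_comp_mul ha, ← mul_assoc, mul_inv_cancel₀ ha.ne', one_mul]
    have hdat : ∫ x, ⟪w₀ x, (fun t x => Ψ (a⁻¹ * t) x) 0 x⟫_ℝ = ∫ x, ⟪w₀ x, Ψ 0 x⟫_ℝ := by
      simp only [mul_zero]
    rw [integral_congr_ae (ae_of_all _ hpt), hsub, ← hdat]
    exact key

end IsWeakTensorPassiveVectorOn

end Torus

end Literature.Analysis.FluidPDE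

end
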